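import Literature.AlgebraicGeometry.Morphisms.ClopenPieceOfCoproduct
import HarnessLib

/-!
# A morphism from a preconnected scheme into a coproduct of schemes factors through a leg

Topic: `Literature/AlgebraicGeometry/Morphisms`.  PROOF FILE (theorems only; no definition, no named
fact).  Let `(f_i : X_i ⟶ S)_{i ∈ σ}` be a COLIMIT cofan in `Scheme` (so `S ≅ ∐_i X_i`), and let
`p : T ⟶ S` be a morphism from a PRECONNECTED scheme `T`.

* `range_subset_range_of_mem` — if ONE point `w` of `T` is mapped into the image of the leg `f_i`, then
  the whole image of `p` lies in it: the image of `p` is preconnected, the image of `f_i` is open and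
  closed (★ `isClopen_range_of_isColimit_cofan`), and a preconnected set meeting an open-and-closed set
  lies inside it (Mathlib `IsPreconnected.subset_isClopen`);
* `exists_fac_of_mem_range` — hence `p` FACTORS through that leg, `p = pc ≫ f_i` (the legs are open
  immersions, ★ `isOpenImmersion_of_isColimit_cofan`, and a morphism whose image lies in the image of
  an open immersion lifts through it, Mathlib `IsOpenImmersion.lift` / `lift_fac`) — the POINTED form;
* `exists_fac_of_preconnectedSpace` — for `T` preconnected and non-empty, `p` factors through SOME leg (the images of
  the legs cover `S`, ★ `exists_eq_of_isColimit_cofan`);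
* `cofanFac_unique`, `cofanFac_index_unique` — the factorisation through a given leg is unique (open
  immersions are monomorphisms) and, for non-empty `T`, the index of the leg is unique (the images of
  distinct legs are disjoint, ★ `pairwise_disjoint_range_of_isColimit_cofan`);
* §2: for a colimit cofan in `Over B` (e.g. the tree's `SchemeOver k = Over (Spec k)`), the POINTED
  factorisation `exists_fac_of_isColimit_cofan_of_mem` — `Over.forget B` creates, hence preserves, the
  coproduct (★ `isColimit_cofan_left`), and the lift of underlying schemes is automatically a
  `B`-morphism.

This is the elementary fact "a connected scheme mapping to `∐ X_i` lands in exactly one `X_i`"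
(Görtz–Wedhorn I, Lemma 1.19 (1) with §(3.5) Example 3.11; Stacks 080G/04PX for the topology), in the
LIGHT import cone of ★ `Morphisms/ClopenPieceOfCoproduct` (consumers: the unitary Shimura-curve
embedding restricted to a connected piece of the source, factored through a named piece of the
target record's cofan — cell hodgecm-mathlib, GS-7 (7-src)/(7-main)).  SEARCH-BEFORE-STATE, NOT
RESTATED HERE: for a CONNECTED apex in `Over B` the un-pointed factorisation «through SOME leg» and
both uniqueness statements are ★
`Literature.NumberTheory.Automorphic.Liu2021.AppendixC.exists_comp_eq_of_connectedSpace` /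
`comp_eq_unique` / `index_unique` (`Liu2021/Lemma24Helpers.lean` §1, same proof route) — the names of
record for those forms; what this file adds is the POINTED form (factor through a PRESCRIBED leg met
by one point, no index search) and the plain-`Scheme` forms.  A PRIVATE open-subset variant is
`Liu2021/AlbaneseCocycleOfPieces.exists_lift_piece`.
Mathlib searched: `IsOpenImmersion.lift`, `IsOpenImmersion.lift_fac`, `IsPreconnected.subset_isClopen`,
`isPreconnected_range`, `Over.homMk`, `Over.w`, `cancel_mono` (used); no statement factoring a morphism
from a (pre)connected scheme through a summand of a coproduct.

## References
* [GortzWedhorn2020] U. Görtz, T. Wedhorn, *Algebraic Geometry I: Schemes* (2nd ed. 2020), Lemma 1.19 (1)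
  (§(1.5): a connected subset meeting an open-and-closed subset lies inside it), §(3.5) Proposition 3.10
  and Example 3.11 (coproducts of schemes are disjoint unions; p. 73), Exercise 3.16.
* [StacksProject] The Stacks Project, Tags 080G, 04PX (connected components; open-and-closed subsets).
-/

set_option autoImplicit false

noncomputable section

open CategoryTheory CategoryTheory.Limits AlgebraicGeometry Set Function

namespace Literature.AlgebraicGeometry.Morphisms

open _root_.Topology

universe v u

/-! ## §1 Colimit cofans in `Scheme` -/

section Scheme

variable {σ : Type v} [Small.{u} σ] {X : σ → Scheme.{u}} {S : Scheme.{u}} {f : ∀ i, X i ⟶ S}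

/-- **The image of a preconnected scheme meeting the image of a leg lies inside it.**  For a colimit
cofan `(f_i : X_i ⟶ S)` of schemes, a morphism `p : T ⟶ S` from a preconnected scheme `T` and a point
`w` of `T` with `p w` in the image of `f_i`, the whole image of `p` lies in the image of `f_i`: the
image of `p` is preconnected (continuous image), the image of `f_i` is open and closed
(★ `isClopen_range_of_isColimit_cofan`), and Mathlib `IsPreconnected.subset_isClopen` applies
(Görtz–Wedhorn I, Lemma 1.19 (1); Stacks 04PX).
[cite: GortzWedhorn2020, Lemma 1.19 (1) (§(1.5)) with §(3.5) Example 3.11 (p. 73)] -/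
theorem range_subset_range_of_mem (hc : IsColimit (Cofan.mk S f)) {T : Scheme.{u}}
    [PreconnectedSpace T] (p : T ⟶ S) (w : T) (i : σ) (hw : p w ∈ Set.range (f i)) :
    Set.range p ⊆ Set.range (f i) :=
  (isPreconnected_range p.continuous).subset_isClopen (isClopen_range_of_isColimit_cofan hc i)
    ⟨p w, ⟨w, rfl⟩, hw⟩

/-- **A morphism from a preconnected scheme into a coproduct of schemes factors through the leg its
image meets (pointed form).**  For a colimit cofan `(f_i : X_i ⟶ S)`, `p : T ⟶ S` with `T`
preconnected and a point `w` of `T` with `p w ∈ f_i(X_i)`, there is `pc : T ⟶ X_i` with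
`pc ≫ f_i = p`: by `range_subset_range_of_mem` the image of `p` lies in the image of the open
immersion `f_i` (★ `isOpenImmersion_of_isColimit_cofan`), so `p` lifts through it (Mathlib
`IsOpenImmersion.lift`, `IsOpenImmersion.lift_fac`) (Görtz–Wedhorn I, Lemma 1.19 (1), §(3.5)
Example 3.11). [cite: GortzWedhorn2020, Lemma 1.19 (1) (§(1.5)) with §(3.5) Example 3.11 (p. 73)] -/
theorem exists_fac_of_mem_range (hc : IsColimit (Cofan.mk S f)) {T : Scheme.{u}} [PreconnectedSpace T]
    (p : T ⟶ S) (w : T) (i : σ) (hw : p w ∈ Set.range (f i)) :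
    ∃ pc : T ⟶ X i, pc ≫ f i = p := by
  haveI := isOpenImmersion_of_isColimit_cofan hc i
  exact ⟨IsOpenImmersion.lift (f i) p (range_subset_range_of_mem hc p w i hw),
    IsOpenImmersion.lift_fac _ _ _⟩

/-- **A morphism from a non-empty preconnected scheme into a coproduct of schemes factors through
some leg**: the images of the legs cover `S` (★ `exists_eq_of_isColimit_cofan`), so any point of
`T` is mapped into the image of some leg `f_i`, and `exists_fac_of_mem_range` applies
(Görtz–Wedhorn I, Lemma 1.19 (1), §(3.5) Example 3.11; Stacks 080G).
[cite: GortzWedhorn2020, Lemma 1.19 (1) (§(1.5)) with §(3.5) Example 3.11 (p. 73)] -/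
theorem exists_fac_of_preconnectedSpace (hc : IsColimit (Cofan.mk S f)) {T : Scheme.{u}} [PreconnectedSpace T]
    [Nonempty T] (p : T ⟶ S) : ∃ (i : σ) (pc : T ⟶ X i), pc ≫ f i = p := by
  obtain ⟨w⟩ := (inferInstance : Nonempty T)
  obtain ⟨i, y, hy⟩ := exists_eq_of_isColimit_cofan hc (p w)
  exact ⟨i, exists_fac_of_mem_range hc p w i ⟨y, hy⟩⟩

/-- **The factorisation through a given leg is unique** (the legs of a colimit cofan of schemes are
open immersions, ★ `isOpenImmersion_of_isColimit_cofan`, hence monomorphisms; Görtz–Wedhorn I,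
§(3.5) Example 3.11). [cite: GortzWedhorn2020, §(3.5) Proposition 3.10 and Example 3.11 (disjoint union of schemes, p. 73)] -/
theorem cofanFac_unique (hc : IsColimit (Cofan.mk S f)) {T : Scheme.{u}} {i : σ} (pc pc' : T ⟶ X i)
    (h : pc ≫ f i = pc' ≫ f i) : pc = pc' := by
  haveI := isOpenImmersion_of_isColimit_cofan hc i
  exact (cancel_mono (f i)).1 h

/-- **The leg through which a morphism from a NON-EMPTY scheme factors is unique**: if `p : T ⟶ S`
factors through the legs `f_i` and `f_j`, then `i = j` (the images of distinct legs of a colimit cofan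
of schemes are disjoint, ★ `pairwise_disjoint_range_of_isColimit_cofan`, and both contain `p w` for any
point `w` of `T`; Görtz–Wedhorn I, §(3.5) Example 3.11).
[cite: GortzWedhorn2020, §(3.5) Proposition 3.10 and Example 3.11 (disjoint union of schemes, p. 73)] -/
theorem cofanFac_index_unique (hc : IsColimit (Cofan.mk S f)) {T : Scheme.{u}} [Nonempty T] {p : T ⟶ S}
    {i j : σ} (pc : T ⟶ X i) (pc' : T ⟶ X j) (h : pc ≫ f i = p) (h' : pc' ≫ f j = p) : i = j := by
  by_contra hne
  obtain ⟨w⟩ := (inferInstance : Nonempty T)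
  have hd : Disjoint (Set.range (f i)) (Set.range (f j)) :=
    pairwise_disjoint_range_of_isColimit_cofan hc hne
  have h1 : f i (pc w) = p w := by rw [← Scheme.Hom.comp_apply, h]
  have h2 : f j (pc' w) = p w := by rw [← Scheme.Hom.comp_apply, h']
  exact Set.disjoint_left.1 hd ⟨pc w, h1⟩ ⟨pc' w, h2⟩

end Scheme

/-! ## §2 Colimit cofans in `Over B` -/

section Over

variable {σ : Type v} [Small.{u} σ] {B : Scheme.{u}} {X : σ → Over B} {S : Over B}
  {f : ∀ i, X i ⟶ S}

/-- **Pointed factorisation over a base.**  For a colimit cofan `(f_i : X_i ⟶ S)` in `Over B`, a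
`B`-morphism `p : T ⟶ S` from a `B`-scheme with preconnected underlying space, and a point `w` of `T`
with `p w` in the image of the leg `f_i`, there is a `B`-morphism `pc : T ⟶ X_i` with `pc ≫ f_i = p`:
the underlying cofan of schemes is a colimit (★ `isColimit_cofan_left`), `exists_fac_of_mem_range`
lifts the underlying morphism, and a lift of underlying schemes through a leg commutes with the
structure maps to `B` automatically (Görtz–Wedhorn I, Lemma 1.19 (1), §(3.5) Example 3.11; e.g.
`B = Spec k`, the tree's `SchemeOver k`). [cite: GortzWedhorn2020, Lemma 1.19 (1) (§(1.5)) with §(3.5) Example 3.11 (p. 73)] -/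
theorem exists_fac_of_isColimit_cofan_of_mem (hc : IsColimit (Cofan.mk S f)) {T : Over B}
    [PreconnectedSpace T.left] (p : T ⟶ S) (w : T.left) (i : σ)
    (hw : p.left w ∈ Set.range (f i).left) : ∃ pc : T ⟶ X i, pc ≫ f i = p := by
  obtain ⟨hc'⟩ := isColimit_cofan_left hc
  obtain ⟨l, hl⟩ := exists_fac_of_mem_range hc' p.left w i hw
  have hw' : l ≫ (X i).hom = T.hom := by
    rw [← Over.w (f i), ← Category.assoc, hl, Over.w p]
  exact ⟨Over.homMk l hw', Over.OverMorphism.ext hl⟩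

end Over

end Literature.AlgebraicGeometry.Morphisms

end
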